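import Summits.AtomisticToContinuum.Crystallization.Theorems.PerronTransitivityUniformBindingRigidityPeriodicLeast

/-!
# Negative knowledge for crux `PerronTransitivity.UniformBindingRigidity` (stmt-AtomisticToContinuum-15099), II:
# the periodic class is never uniformly strictly super-bound — `2E*` is the exact ceiling (zero slack)

Refuter vetting (crux-attack, `--supports stmt-AtomisticToContinuum-15099`). With `U_P(p) = ∑'_{q ∈ P.points, q ≠ p} V_LJ(dist p q)`
and `E* = ⨅_Q e_LJ(Q)` (a genuine infimum, `ChargedEnergyGapNegative.eStar_le`, item 0714):

* `energyPerParticle_lt_of_motif_site_lt` — strict motif averaging: all motif sites `< 2c` gives `e(P) < c`.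
* `not_forall_site_lt` — **no periodic configuration of `ℝ³` has every site bound strictly better than the crystal
  average**: `¬ ∀ p ∈ P.points, U_P(p) < 2E*` (else `e(P) < E* ≤ e(P)`); equivalently `exists_site_ge`: some site has
  `2E* ≤ U_P(p)`. So inside the periodic class the threshold of M* cannot be lowered: the hypothesis "uniformly `2E*`-bound"
  is the minimax-extremal one, and a counterexample to M* must be NON-periodic (for periodic `X` the crux is closed by the
  landed `stub_periodicLeast`).
* `motif_site_eq_of_bound` — **zero slack made formal**: in a uniformly `2E*`-bound periodic configuration every motif site is
  bound at EXACTLY `2E*` (one strictly super-bound motif site would again force `e(P) < E*`).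
All `[folklore]`.
-/

noncomputable section

namespace Summit.AtomisticToContinuum.Crystallization.Theorems.UniformBindingRigidity.Negative.PeriodicCeiling

open Literature.MathematicalPhysics.StatisticalMechanics
open Summit.AtomisticToContinuum.Crystallization.Theorems.ChargedEnergyGapNegative (eStar eStar_le)
open scoped BigOperators

/-- **Strict motif averaging**: if every motif site energy of a periodic configuration `P` is `< 2c`, then
`e(P) = (2·#F)⁻¹ ∑_{x ∈ F} U_P(x) < c` (`F ≠ ∅`). [folklore] -/
theorem energyPerParticle_lt_of_motif_site_lt {d : ℕ} (V : ℝ → ℝ) (P : PeriodicConfiguration d) {c : ℝ}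
    (h : ∀ x ∈ P.motif,
      ∑' y : {y : EuclideanSpace ℝ (Fin d) // y ∈ P.points ∧ y ≠ x}, V (dist x y.1) < 2 * c) :
    P.energyPerParticle V < c := by
  have hcard : (0 : ℝ) < P.motif.card := by exact_mod_cast P.motif_nonempty.card_pos
  have hsum := Finset.sum_lt_sum_of_nonempty P.motif_nonempty h
  rw [Finset.sum_const, nsmul_eq_mul] at hsum
  unfold PeriodicConfiguration.energyPerParticle
  calc (2 * (P.motif.card : ℝ))⁻¹ *
        ∑ x ∈ P.motif, ∑' y : {y : EuclideanSpace ℝ (Fin d) // y ∈ P.points ∧ y ≠ x}, V (dist x y.1)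
      < (2 * (P.motif.card : ℝ))⁻¹ * ((P.motif.card : ℝ) * (2 * c)) :=
        mul_lt_mul_of_pos_left hsum (by positivity)
    _ = (2 * (P.motif.card : ℝ))⁻¹ * ((2 * (P.motif.card : ℝ)) * c) := by ring
    _ = c := inv_mul_cancel_left₀ (mul_pos two_pos hcard).ne' c

/-- **Mixed motif averaging**: all motif sites `≤ 2c` and one motif site `< 2c` still give `e(P) < c`. [folklore] -/
theorem energyPerParticle_lt_of_motif_site_le_of_lt {d : ℕ} (V : ℝ → ℝ) (P : PeriodicConfiguration d) {c : ℝ}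
    (h : ∀ x ∈ P.motif,
      ∑' y : {y : EuclideanSpace ℝ (Fin d) // y ∈ P.points ∧ y ≠ x}, V (dist x y.1) ≤ 2 * c)
    {x₀ : EuclideanSpace ℝ (Fin d)} (hx₀ : x₀ ∈ P.motif)
    (hlt : ∑' y : {y : EuclideanSpace ℝ (Fin d) // y ∈ P.points ∧ y ≠ x₀}, V (dist x₀ y.1) < 2 * c) :
    P.energyPerParticle V < c := by
  have hcard : (0 : ℝ) < P.motif.card := by exact_mod_cast P.motif_nonempty.card_pos
  have hsum := Finset.sum_lt_sum h ⟨x₀, hx₀, hlt⟩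
  rw [Finset.sum_const, nsmul_eq_mul] at hsum
  unfold PeriodicConfiguration.energyPerParticle
  calc (2 * (P.motif.card : ℝ))⁻¹ *
        ∑ x ∈ P.motif, ∑' y : {y : EuclideanSpace ℝ (Fin d) // y ∈ P.points ∧ y ≠ x}, V (dist x y.1)
      < (2 * (P.motif.card : ℝ))⁻¹ * ((P.motif.card : ℝ) * (2 * c)) :=
        mul_lt_mul_of_pos_left hsum (by positivity)
    _ = (2 * (P.motif.card : ℝ))⁻¹ * ((2 * (P.motif.card : ℝ)) * c) := by ring
    _ = c := inv_mul_cancel_left₀ (mul_pos two_pos hcard).ne' c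

/-- **No periodic configuration of `ℝ³` is uniformly strictly super-bound**: it is impossible that every site of
`P.points` has Lennard-Jones site energy `< 2E*` (motif points are points; strict averaging gives `e(P) < E* ≤ e(P)`).
[folklore] -/
theorem not_forall_site_lt (P : PeriodicConfiguration 3) :
    ¬ ∀ p ∈ P.points, ∑' q : {q : EuclideanSpace ℝ (Fin 3) // q ∈ P.points ∧ q ≠ p}, lennardJones (dist p q.1) <
        2 * ⨅ Q : PeriodicConfiguration 3, Q.energyPerParticle lennardJones := by
  intro h
  have hlt : P.energyPerParticle lennardJones < eStar :=
    energyPerParticle_lt_of_motif_site_lt lennardJones P fun x hx => h x (P.mem_points_of_mem_motif hx)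
  exact absurd (eStar_le P) (not_le.2 hlt)

/-- Equivalently: **every periodic configuration of `ℝ³` has a site bound no better than the crystal average**,
`∃ p ∈ P.points, 2E* ≤ U_P(p)`. [folklore] -/
theorem exists_site_ge (P : PeriodicConfiguration 3) :
    ∃ p ∈ P.points, 2 * (⨅ Q : PeriodicConfiguration 3, Q.energyPerParticle lennardJones) ≤
      ∑' q : {q : EuclideanSpace ℝ (Fin 3) // q ∈ P.points ∧ q ≠ p}, lennardJones (dist p q.1) := by
  by_contra h
  push Not at h
  exact not_forall_site_lt P h

/-- **Zero slack**: if every site of a periodic configuration of `ℝ³` is bound `≤ 2E*`, then every motif site is bound at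
EXACTLY `2E*` (a strictly super-bound motif site would force `e(P) < E*`). [folklore] -/
theorem motif_site_eq_of_bound (P : PeriodicConfiguration 3)
    (hP : ∀ p ∈ P.points, ∑' q : {q : EuclideanSpace ℝ (Fin 3) // q ∈ P.points ∧ q ≠ p}, lennardJones (dist p q.1) ≤
        2 * ⨅ Q : PeriodicConfiguration 3, Q.energyPerParticle lennardJones) :
    ∀ x ∈ P.motif, ∑' q : {q : EuclideanSpace ℝ (Fin 3) // q ∈ P.points ∧ q ≠ x}, lennardJones (dist x q.1) =
        2 * ⨅ Q : PeriodicConfiguration 3, Q.energyPerParticle lennardJones := by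
  intro x hx
  refine le_antisymm (hP x (P.mem_points_of_mem_motif hx)) (not_lt.1 fun hlt => ?_)
  have h : P.energyPerParticle lennardJones < eStar :=
    energyPerParticle_lt_of_motif_site_le_of_lt lennardJones P
      (fun y hy => hP y (P.mem_points_of_mem_motif hy)) hx hlt
  exact absurd (eStar_le P) (not_le.2 h)

end Summit.AtomisticToContinuum.Crystallization.Theorems.UniformBindingRigidity.Negative.PeriodicCeiling

end
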